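import Literature.Barriers.CriticalPhenomena.ScaleCovarianceNotMoebius
import Literature.MathematicalPhysics.QuantumFieldTheory.PointwiseOSReconstruction

/-!
# `InversionUpgradeNormalised` (item stmt-CriticalPhenomena-1982): downward rigidity under reflection positivity — abstract part

Negative knowledge about the crux
`Summit.CriticalPhenomena.Ising3DConformalLimit.Theses.HyperoctahedralRP.InversionUpgradeNormalised`
(standing crux disprover, cycle 3). Elementary consequences of the positivity of the `3 × 3` OS
Gram matrices of the pointwise reflection positivity `IsReflectionPositiveAlong`, all from ONE
discriminant inequality (`rp_three`, `downward_step`):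

* `downward_rigidity`, `ratio_sq_le_one` — **DOWNWARD RIGIDITY**: let `S` be reflection positive
  along `τ` with `K(∅,∅) = S₀ = 1`. If for two half-space configurations `a, b` the `2n`-point OS
  entries CLUSTER onto a product `R(a)R(b)` when `a, b` are pushed away from the mirror
  (`K(a_L,a_L) → R(a)²`, `σ(a_L,b_L) → R(a)R(b)`, `K(b_L,b_L) → R(b)²`) while the vacuum rows
  `σ(∅,a_L) = S_n(a)` do not move (translation invariance), then `S_n(a)/R(a) = S_n(b)/R(b)` and
  `(S_n(a)/R(a))² ≤ 1`: under RP the `2n`-point function pins the `n`-point function up to ONE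
  multiplicative constant `γ ∈ [-1, 1]`. Instances on tree objects: `DownwardRigidityWickFour.lean`
  (`S₄ = wick Δ ⇒ S₂ = γ·twoPt Δ`) and `DownwardRigidityWickEight.lean`
  (`S₈ = wick8 Δ ⇒ S₄ = γ·wick Δ ⇒` the inversion identity AT ORDER FOUR). Consequence for the
  crux: an RP decoy cannot be a finite-order deformation of the generalized free field — it is
  non-Gaussian at orders `4, 8, 16, …` at once (complements `SixPoint.lean`: WITHOUT positivity
  order `4` does not control order `6`; and `ReflectionPositiveOrders.lean`: RP families have no
  vanishing even order).
* `osSym_row_eq_of_degenerate` — degenerate one-point OS vectors freeze every OS row (used in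
  `ScaleZeroDressing.lean`: weight-`0` RP "shape factors" are rigid, so Schur products
  `GFF_Δ ⊙ K` give no decoy either).
* bookkeeping: `osSym` (symmetrised OS kernel), `osPointKernel_empty_left/right`, `osSym_empty`,
  `osSym_empty_timeShift` (configurations are pushed away from the mirror with the library's
  `HalfSpaceConfig.timeShift`).

All statements are model-blind negative lemmas (no Theses conclusion is asserted).
-/

noncomputable section

namespace Summit.CriticalPhenomena.Ising3DConformalLimit.InversionUpgradeNormalisedNegative

open Literature.Probability.LatticeModels Literature.Barriers.CriticalPhenomena
open Literature.MathematicalPhysics.QuantumFieldTheory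
open Filter Set Function ScaleNotMoebius EuclideanGeometry
open scoped Topology RealInnerProductSpace

variable {d : ℕ} {τ : Fin d}

/-! ## The discriminant lemmas -/

/-- If `t² + 2tsp + s²r ≥ 0` for all real `t, s`, then `p² ≤ r`. [folklore] -/
theorem sq_le_of_forall_quadratic_nonneg {p r : ℝ}
    (h : ∀ t s : ℝ, 0 ≤ t ^ 2 + 2 * t * s * p + s ^ 2 * r) : p ^ 2 ≤ r := by
  have := h (-p) 1
  nlinarith

/-- If `A t² + 2tp ≥ 0` for all real `t`, then `p = 0`. [folklore] -/
theorem eq_zero_of_forall_quadratic_nonneg {A p : ℝ} (h : ∀ t : ℝ, 0 ≤ A * t ^ 2 + 2 * t * p) :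
    p = 0 := by
  by_contra hp
  have hp2 : 0 < p ^ 2 := by positivity
  rcases le_or_gt A 0 with hA | hA
  · have := h (-p)
    nlinarith
  · have := h (-p / A)
    have e : A * (-p / A) ^ 2 + 2 * (-p / A) * p = -(p ^ 2) / A := by
      field_simp; ring
    rw [e] at this
    have : 0 < p ^ 2 / A := div_pos hp2 hA
    have : -(p ^ 2) / A = -(p ^ 2 / A) := by ring
    linarith

/-! ## Three-configuration reflection positivity -/

/-- The symmetrised OS kernel `(K(a,b) + K(b,a))/2` (only the symmetric part of the OS matrix
enters the quadratic form of `IsReflectionPositiveAlong`). [folklore] -/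
def osSym (S : CorrFamily d) (a b : HalfSpaceConfig d τ) : ℝ :=
  (osPointKernel S a b + osPointKernel S b a) / 2

/-- `osSym` on the diagonal is the OS kernel. [folklore] -/
theorem osSym_self (S : CorrFamily d) (a : HalfSpaceConfig d τ) : osSym S a a = osPointKernel S a a := by
  unfold osSym; ring

/-- `osSym` is symmetric. [folklore] -/
theorem osSym_comm (S : CorrFamily d) (a b : HalfSpaceConfig d τ) : osSym S a b = osSym S b a := by
  unfold osSym; ring

/-- **Reflection positivity on three configurations**, written out. [folklore] -/
theorem rp_three {S : CorrFamily d} (hRP : IsReflectionPositiveAlong τ S)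
    (a₀ a₁ a₂ : HalfSpaceConfig d τ) (c₀ c₁ c₂ : ℝ) :
    0 ≤ c₀ ^ 2 * osPointKernel S a₀ a₀ + c₁ ^ 2 * osPointKernel S a₁ a₁ + c₂ ^ 2 * osPointKernel S a₂ a₂
      + 2 * c₀ * c₁ * osSym S a₀ a₁ + 2 * c₀ * c₂ * osSym S a₀ a₂ + 2 * c₁ * c₂ * osSym S a₁ a₂ := by
  have h := hRP 3 ![a₀, a₁, a₂] ![c₀, c₁, c₂]
  simp only [Fin.sum_univ_three, Matrix.cons_val_zero, Matrix.cons_val_one,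
    Matrix.cons_val_two, Matrix.head_cons, Matrix.tail_cons] at h
  calc (0 : ℝ) ≤ c₀ * c₀ * osPointKernel S a₀ a₀ + c₀ * c₁ * osPointKernel S a₀ a₁
        + c₀ * c₂ * osPointKernel S a₀ a₂
      + (c₁ * c₀ * osPointKernel S a₁ a₀ + c₁ * c₁ * osPointKernel S a₁ a₁ + c₁ * c₂ * osPointKernel S a₁ a₂)
      + (c₂ * c₀ * osPointKernel S a₂ a₀ + c₂ * c₁ * osPointKernel S a₂ a₁ + c₂ * c₂ * osPointKernel S a₂ a₂) := h
    _ = _ := by unfold osSym; ring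

/-- **The downward step (finite form).** For the empty configuration `∅` (`S₀`-entry `K(∅,∅) = 1`)
and two half-space configurations `a, b` with normalisers `rₐ, r_b ≠ 0`:
`(σ(a)/rₐ - σ(b)/r_b)² ≤ K(a,a)/rₐ² - 2σ(a,b)/(rₐ r_b) + K(b,b)/r_b²`, where `σ(a) = osSym S ∅ a`
(`= S_n(a)` for a reflection-invariant family) — positivity of the OS Gram matrix of `(∅, a, b)`
with coefficients `(t, s/rₐ, -s/r_b)`. [folklore] -/
theorem downward_step {S : CorrFamily d} (hRP : IsReflectionPositiveAlong τ S)
    (h0 : osPointKernel S (HalfSpaceConfig.empty d τ) (HalfSpaceConfig.empty d τ) = 1)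
    (a b : HalfSpaceConfig d τ) {ra rb : ℝ} (hra : ra ≠ 0) (hrb : rb ≠ 0) :
    (osSym S (HalfSpaceConfig.empty d τ) a / ra - osSym S (HalfSpaceConfig.empty d τ) b / rb) ^ 2 ≤
      osPointKernel S a a / ra ^ 2 - 2 * osSym S a b / (ra * rb) + osPointKernel S b b / rb ^ 2 := by
  apply sq_le_of_forall_quadratic_nonneg
  intro t s
  have h := rp_three hRP (HalfSpaceConfig.empty d τ) a b t (s / ra) (-(s / rb))
  rw [h0] at h
  calc (0 : ℝ) ≤ _ := h
    _ = _ := by field_simp; ring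

/-- **Cauchy–Schwarz with the vacuum (finite form).** `(σ(a)/rₐ)² ≤ K(a,a)/rₐ²`. [folklore] -/
theorem ratio_sq_le {S : CorrFamily d} (hRP : IsReflectionPositiveAlong τ S)
    (h0 : osPointKernel S (HalfSpaceConfig.empty d τ) (HalfSpaceConfig.empty d τ) = 1)
    (a : HalfSpaceConfig d τ) {ra : ℝ} (hra : ra ≠ 0) :
    (osSym S (HalfSpaceConfig.empty d τ) a / ra) ^ 2 ≤ osPointKernel S a a / ra ^ 2 := by
  apply sq_le_of_forall_quadratic_nonneg
  intro t s
  have h := rp_three hRP (HalfSpaceConfig.empty d τ) a a t (s / ra) 0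
  rw [h0] at h
  calc (0 : ℝ) ≤ _ := h
    _ = _ := by field_simp; ring

/-! ## Pushing configurations away from the mirror: `HalfSpaceConfig.timeShift` -/

/-- **DOWNWARD RIGIDITY (limit form).** Let `S` be reflection positive along `τ` with `K(∅,∅) = 1`.
If for two half-space configurations `a, b` and normalisers `rₐ, r_b ≠ 0` the vacuum rows do not
move under the time translation `T(L)` (`σ(∅, a_L) = σ(∅, a)`, `σ(∅, b_L) = σ(∅, b)`, `L ≥ 0`) while
the `2n`-point entries CLUSTER, `K(a_L,a_L) → rₐ²`, `σ(a_L,b_L) → rₐ r_b`, `K(b_L,b_L) → r_b²` as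
`L → ∞`, then `σ(∅,a)/rₐ = σ(∅,b)/r_b`. (The right-hand side of `downward_step` tends to
`1 - 2 + 1 = 0` while the left-hand side is constant.) In words: under RP the `2n`-point function
pins the `n`-point function up to ONE multiplicative constant. [folklore] -/
theorem downward_rigidity {S : CorrFamily d} (hRP : IsReflectionPositiveAlong τ S)
    (h0 : osPointKernel S (HalfSpaceConfig.empty d τ) (HalfSpaceConfig.empty d τ) = 1)
    (a b : HalfSpaceConfig d τ) {ra rb : ℝ} (hra : ra ≠ 0) (hrb : rb ≠ 0)
    (hσa : ∀ L : ℝ, 0 ≤ L →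
      osSym S (HalfSpaceConfig.empty d τ) (a.timeShift L) = osSym S (HalfSpaceConfig.empty d τ) a)
    (hσb : ∀ L : ℝ, 0 ≤ L →
      osSym S (HalfSpaceConfig.empty d τ) (b.timeShift L) = osSym S (HalfSpaceConfig.empty d τ) b)
    (hA : Tendsto (fun L => osPointKernel S (a.timeShift L) (a.timeShift L)) atTop (𝓝 (ra ^ 2)))
    (hB : Tendsto (fun L => osSym S (a.timeShift L) (b.timeShift L)) atTop (𝓝 (ra * rb)))
    (hC : Tendsto (fun L => osPointKernel S (b.timeShift L) (b.timeShift L)) atTop (𝓝 (rb ^ 2))) :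
    osSym S (HalfSpaceConfig.empty d τ) a / ra = osSym S (HalfSpaceConfig.empty d τ) b / rb := by
  set P := osSym S (HalfSpaceConfig.empty d τ) a / ra - osSym S (HalfSpaceConfig.empty d τ) b / rb
    with hP
  have hR : Tendsto (fun L => osPointKernel S (a.timeShift L) (a.timeShift L) / ra ^ 2
      - 2 * osSym S (a.timeShift L) (b.timeShift L) / (ra * rb)
      + osPointKernel S (b.timeShift L) (b.timeShift L) / rb ^ 2) atTop
      (𝓝 (ra ^ 2 / ra ^ 2 - 2 * (ra * rb) / (ra * rb) + rb ^ 2 / rb ^ 2)) :=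
    ((hA.div_const _).sub ((hB.const_mul 2).div_const _)).add (hC.div_const _)
  have hlim : ra ^ 2 / ra ^ 2 - 2 * (ra * rb) / (ra * rb) + rb ^ 2 / rb ^ 2 = 0 := by
    field_simp; ring
  have hev : ∀ᶠ L in atTop, P ^ 2 ≤ osPointKernel S (a.timeShift L) (a.timeShift L) / ra ^ 2
      - 2 * osSym S (a.timeShift L) (b.timeShift L) / (ra * rb)
      + osPointKernel S (b.timeShift L) (b.timeShift L) / rb ^ 2 := by
    filter_upwards [eventually_ge_atTop (0 : ℝ)] with L hL
    have := downward_step hRP h0 (a.timeShift L) (b.timeShift L) hra hrb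
    rwa [hσa L hL, hσb L hL] at this
  have hP2 : P ^ 2 ≤ 0 := hlim ▸ ge_of_tendsto hR hev
  have hP0 : P = 0 := by nlinarith [sq_nonneg P]
  exact sub_eq_zero.mp hP0

/-- **`|γ| ≤ 1`.** Under the same clustering of `K(a_L,a_L)`, `(σ(∅,a)/rₐ)² ≤ 1`. [folklore] -/
theorem ratio_sq_le_one {S : CorrFamily d} (hRP : IsReflectionPositiveAlong τ S)
    (h0 : osPointKernel S (HalfSpaceConfig.empty d τ) (HalfSpaceConfig.empty d τ) = 1)
    (a : HalfSpaceConfig d τ) {ra : ℝ} (hra : ra ≠ 0)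
    (hσa : ∀ L : ℝ, 0 ≤ L →
      osSym S (HalfSpaceConfig.empty d τ) (a.timeShift L) = osSym S (HalfSpaceConfig.empty d τ) a)
    (hA : Tendsto (fun L => osPointKernel S (a.timeShift L) (a.timeShift L)) atTop (𝓝 (ra ^ 2))) :
    (osSym S (HalfSpaceConfig.empty d τ) a / ra) ^ 2 ≤ 1 := by
  have hR : Tendsto (fun L => osPointKernel S (a.timeShift L) (a.timeShift L) / ra ^ 2) atTop
      (𝓝 (ra ^ 2 / ra ^ 2)) := hA.div_const _
  have hlim : ra ^ 2 / ra ^ 2 = 1 := by field_simp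
  have hev : ∀ᶠ L in atTop, (osSym S (HalfSpaceConfig.empty d τ) a / ra) ^ 2 ≤
      osPointKernel S (a.timeShift L) (a.timeShift L) / ra ^ 2 := by
    filter_upwards [eventually_ge_atTop (0 : ℝ)] with L hL
    have := ratio_sq_le hRP h0 (a.timeShift L) hra
    rwa [hσa L hL] at this
  exact hlim ▸ ge_of_tendsto hR hev

/-! ## Reading the vacuum row: `σ(a) = S_n(a)` for translation- and reflection-invariant families -/

/-- `K(∅, a) = S_n(a)`. [folklore] -/
theorem osPointKernel_empty_left (S : CorrFamily d) (a : HalfSpaceConfig d τ) :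
    osPointKernel S (HalfSpaceConfig.empty d τ) a = S a.n a.pts := by
  unfold osPointKernel
  rw [Fin.append_left_nil _ _ (show (HalfSpaceConfig.empty d τ).n = 0 from rfl)]
  exact corrFamily_comp_cast S _ a.pts

/-- `K(a, ∅) = S_n(θ a)`. [folklore] -/
theorem osPointKernel_empty_right (S : CorrFamily d) (a : HalfSpaceConfig d τ) :
    osPointKernel S a (HalfSpaceConfig.empty d τ) = S a.n (fun i => axisReflection τ (a.pts i)) := by
  unfold osPointKernel
  rw [Fin.append_right_nil _ _ (show (HalfSpaceConfig.empty d τ).n = 0 from rfl)]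
  exact corrFamily_comp_cast S _ _

/-- `K(∅, ∅) = S₀`. [folklore] -/
theorem osPointKernel_empty_empty (S : CorrFamily d) (h0 : ∀ x, S 0 x = 1) :
    osPointKernel S (HalfSpaceConfig.empty d τ) (HalfSpaceConfig.empty d τ) = 1 := by
  rw [osPointKernel_empty_left]; exact h0 _

/-- For a reflection-invariant family the vacuum row is `σ(a) = S_n(a)`. [folklore] -/
theorem osSym_empty (S : CorrFamily d) (hR : IsReflectionInvariantAlong τ S) (a : HalfSpaceConfig d τ) :
    osSym S (HalfSpaceConfig.empty d τ) a = S a.n a.pts := by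
  unfold osSym
  rw [osPointKernel_empty_left, osPointKernel_empty_right, hR]
  ring

/-- … and it does not move under the time translation `T(L)`, `L ≥ 0`, if the family is
translation invariant. [folklore] -/
theorem osSym_empty_timeShift (S : CorrFamily d) (hT : IsTranslationInvariant S)
    (hR : IsReflectionInvariantAlong τ S) (a : HalfSpaceConfig d τ) {L : ℝ} (hL : 0 ≤ L) :
    osSym S (HalfSpaceConfig.empty d τ) (a.timeShift L) = osSym S (HalfSpaceConfig.empty d τ) a := by
  rw [HalfSpaceConfig.timeShift_of_nonneg hL, osSym_empty S hR, osSym_empty S hR]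
  show S a.n (fun i => a.pts i + EuclideanSpace.single τ L) = S a.n a.pts
  exact hT a.n _ a.pts

/-! ## Degenerate one-point vectors freeze the OS rows -/

/-- **Degenerate one-point vectors freeze the OS rows.** If two one-point (or any) configurations
`x, y` have `K(x,x) = σ(x,y) = K(y,y)`, then `σ(x, b) = σ(y, b)` for every configuration `b`:
the OS vectors of `x` and `y` coincide (OS Gram matrix of `(x, y, b)` with coefficients
`(c, -c, t)`). [folklore] -/
theorem osSym_row_eq_of_degenerate {S : CorrFamily d} (hRP : IsReflectionPositiveAlong τ S)
    (x y b : HalfSpaceConfig d τ) {k : ℝ} (hxx : osPointKernel S x x = k) (hyy : osPointKernel S y y = k)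
    (hxy : osSym S x y = k) : osSym S x b = osSym S y b := by
  have h : ∀ t : ℝ, 0 ≤ osPointKernel S b b * t ^ 2 + 2 * t * (osSym S x b - osSym S y b) := by
    intro t
    have := rp_three hRP x y b 1 (-1) t
    rw [hxx, hyy, hxy] at this
    nlinarith
  exact sub_eq_zero.mp (eq_zero_of_forall_quadratic_nonneg h)

end Summit.CriticalPhenomena.Ising3DConformalLimit.InversionUpgradeNormalisedNegative

end
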